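import Summits.QuantumFields.YangMills.Theorems.EndpointGivenBR13SepCoPH.Negative.RemNamedJets13FalseOfTwoNormalisations
import Literature.MathematicalPhysics.QuantumFieldTheory.Balaban1983to89.Beta.DriftRemainder
import Summits.QuantumFields.YangMills.Theses.BalabanUVNodes

/-!
# Crux K2⁷ `EndpointGivenBR13SepCoPH` (stmt-QuantumFields-20543), LINE 1′ «named jets» — THE SHARED LETTER OF RECORD `RemAt F κ θ hP c`, EDITION 3:
# the record's β shadows the named numbers READ AT SCALE `c` (the stub texts put `c := θ.cβ`, the tuple's chart constant) — CONSTANT remainder with the cap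
# `s ≤ c · stepBal 2 F.L` + PER-SCALE ANCHOR at `c • beta0OfJs F κ` + (C); κ chosen AFTER θ; the composition to the crux decl BY NAME; the identification; the lattice

Cell `ym-nodeO-ideate`, DEFINER seat `ym-nodeO-def-1` (gen 2; director-ym R361 ∕ №21 ∕ LINE №203).  TRIGGERS: plan g80's (t-REM) RULING `[YMPLAN-G80-STATE+CLOSE]` («K2⁷ v4 is cut the
hour p590583 is LANDED+BUILT and DEF-1's sketch ed.3 adopts the constant-remainder + anchor `RemAt` letter and∕or the CORE conjunct drop — or declines with reason»; «DEF-1 stays the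
letter's ONE declarer») and CRIT-1 g2's FOLLOW-THROUGH (director-ym LINE №203: v3's stub pair `stub_remNamedJets13 ∧ stub_d1NamedJets13` and an4's constant-form pair are
STUB-MISSTATED modulo `TwoNormalisations`; «REQUIRED in the letter ed.3: quantify κ AFTER θ AND carry θ.cβ in the identification + seam»).  Helper for crux K2⁷ =
stmt-QuantumFields-20543, landed `--supports 20543 --as helper`; count-neutral.  Companion of `Thm/BalabanUVNodesK2JsOfRecord` (this seat, p588621: `StepColourData`, `JsOfRecord`,
`beta0OfJs`, `BoxRemainder`, split-free END, `boxRemainder_unique`), `Thm/BalabanUVNodesK2Line1PrimeRemainderPrice` (b2b-an4 g151, p590583: constant form + per-scale anchor;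
`endpointExistence_of_drift_constRemainder`, `eq_of_anchors`, `anchor_of_boxRemainder`), `Thm/EndpointGivenBR13SepCoPH/Negative/RemNamedJets13FalseOfTwoNormalisations` (CRIT-1 g2,
p592392: the kill of the `∃ κ ∀ θ`, scale-free pairs; `oneLoopDrift_const_mul`) and P3 g50's evidence n°82 e3 ∕ n°83 e2 (phantom `hP`; ceiling conjuncts derivable; `RemAtCCN`).
All four are imported ∕ answered BY NAME below.

THE DECLARER's RULING (edition 3 of the letter registered in plan g80's K2⁷ skeleton v3 bdd723a03d543770 :172–:177).  ADOPT an4's WEAKENING, P3's DROP and CRIT-1's REPAIR: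
  `RemAt F κ θ hP c := ∃ γ₀ s, 0 < γ₀ ∧ γ₀ ≤ θ.γ ∧ s ≤ c · stepBal 2 F.L ∧ ConstRemainder β (c • beta0OfJs F κ) s γ₀ ∧ ScaleAnchor β (c • beta0OfJs F κ) ∧ BetaContH γ₀ β`,
  `β := (datumOfRecord₁₃SepCoPH F 2 θ hP).βfun` (§2; `c • b` spelled `fun k => c * b k`), read by the stub texts AT `c := θ.cβ` with κ AFTER θ (§3):
  STUB 2′ `RemAtSomeJets := ∀ F θ hP, θ.Admissible F 2 → ∃ κ, RemAt F κ θ hP θ.cβ` (v3's name; CRIT-1's `RemAtNEachJets` shape — κ AFTER θ);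
  STUB 1′ `D1AtShadowingJets := ∀ F κ θ hP, θ.Admissible F 2 → RemAt F κ θ hP θ.cβ → ∃ A, OneLoopDrift (stepBal 2 F.L) A (beta0OfJs F κ)` (conclusion = row (D1) at `Lc := F.L`, bare slope).
* DROPPED from v3's letter: the g-proportional modulus `C_r·p_k` (→ a constant `s`; an4: the END reads `BoxRemainder` only through `C_r·p_k ≤ C_r·γ₀ ≤` slope, and the printed chain
  [II] (2.41) → [I] (5.10) → (1.22) delivers the constant form, the linear one needing the un-printed g-derivative clause), `0 ≤ C_r`, and the ceiling conjuncts `0 ≤ β′`,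
  `BetaUpperH β′ γ₀ β` (P3: in the composition stub 1′ supplies a drift, and drift + constant remainder give the ceiling `c·stepBal 2 F.L + 2|c|A + s` — `betaUpperH_of_drift_constRemainder`
  §1; the K1-side reader of v3's ceiling, `Thm/BalabanUVNodesK1EndOfNodes13PWSOfK2NamedJets`, obtains it BY NAME from the two stub texts: `constAnchorPackage_of_remAt_drift` §4).
* KEPT — LOAD-BEARING, not cosmetic: the PER-SCALE ANCHOR «∀ k δ>0 ∃ γ>0, |β_{k+1}(p) − c·beta0OfJs F κ k| ≤ δ on ]0,γ]^{k+1}» ([I] (2.13) p. 268 «vanishes at g_k = 0» read per scale,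
  fixed-cutoff grade).  REASON: `Beta.Drift.OneLoopDrift s A b` (`|Σ_{j<k} b_j − s·k| ≤ A`, [II] (2.38)) PINS THE SLOPE of `b`; under a constant-only letter a colour datum κ′ whose
  numbers sit a constant off the record's (scaled) zero-history numbers satisfies the letter yet drifts at another slope, so stub 1′ «∀ κ, RemAt → drift AT `stepBal 2 F.L`» would be
  refutable by such a κ′ (P3 n°82 `boxRemConst_not_unique` is the generic witness).  With the anchor all data shadowing one record at one scale have the SAME numbers (`ScaleAnchor.eq`,
  `beta0OfJs_eq_of_remAt`), namely `c⁻¹ •` the record's zero-history limits scale by scale, and stub 1′ IS «row (D1) at the record».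
* CARRIED (CRIT-1 g2's repair, REQUIRED): THE SCALE `c`.  The record's β reads the β-chart `(ρ8, bV)` through `polScalar`, BILINEAR in the basis, and Stage-9 admissibility leaves the
  chart constant `θ.cβ ∈ ]0, ∞[` free (`isSuChart_unitsSMul`, `polScalar_unitsSMul` in p592392) — so the un-normalised letters with `∃ κ ∀ θ` (v3, an4's 2″, P3's core, and this seat's
  own INTENT-2 draft = the instances `c = 1` below) are killed modulo `TwoNormalisations` (p592392 `remNamedJets13_pair_false_of_twoNormalisations`,
  `remNamedJetsC_pair_false_of_twoNormalisations`), and a bare quantifier swap is no repair (`lam_eq_one_of_drift_and_drift_mul`).  Edition 3 therefore reads the named numbers AT THE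
  TUPLE's SCALE — reference sequence `θ.cβ • beta0OfJs F κ`, cap `s ≤ θ.cβ · stepBal 2 F.L` — and lets stub 2′ choose κ AFTER θ; stub 1′'s conclusion keeps the BARE slope (the
  composition rescales the drift by `θ.cβ`, `oneLoopDrift_const_mul` BY NAME; no sign of `θ.cβ` is read by the END; the identification reads `θ.cβ ≠ 0` = Stage-9 admissibility).  The
  scale is a PARAMETER `c` of the letter rather than baked in, so that the located convention question — if the β sub-cell's stencil normalisation (`secondMoment ∘ TbalOf`, `stepBal`)
  corresponds to an `IsSuChart` constant `c⋆ ≠ 1`, the texts should read `c := θ.cβ / c⋆` (CRIT-1 sheet §2 caveat) — is a one-token edit of the STUB TEXTS, not of the letter.  NOT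
  decided here: the value of `c⋆` (taken as `1`, i.e. the stencil normalisation is the `hsForm`-unit chart).  The two-normalisation witness MISSES the repaired pair: one κ serves a
  tuple and its rescaled twin (`remAt_rescale`, §2).
* KEPT as a documentary conjunct unread by the composition: `γ₀ ≤ θ.γ` (the box sits inside the record's own coupling window).
* NOTED (P3): `hP` is a PHANTOM binder of the letter (`remAt_iff_hPFree`, `Iff.rfl` against `Node00.betaOfRecord₁₃ F 2 θ.toStage13Params`); the keying on `(θ, hP)` lives in the STUB PREFIX.
* NOTED for the row-(D1) owner: «row (D1) at EVERY colour datum» is not a usable road ((D1) over the pinned family is ONE quartic equation in the colour data,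
  `Gaps.D1WardNoFreeKnob.d1Drift_iff_wardNoFreeKnob`); the use form is keyed on the ANCHOR (`d1AtShadowingJets_of_drift_of_anchor`).
The stub texts themselves are ONE-LINERS over `RemAt` and belong to the registered skeleton (which tags them as obligations); here they are spelled INLINE as hypotheses (no
parameterless `def … : Prop`), VERBATIM as the sketch `Cruxes/EndpointGivenBR13SepCoPH/Def1NamedJetsReshapeSketch.lean` ed.3 and a v4 skeleton spell them.

WHAT IS HERE (3 `def … : Prop` PREDICATES — hypothesis shapes with parameters, never facts — + 23 theorems; 0 `sorry`; elementary real bookkeeping BY NAME):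
§1 generic split-free (`β : HBeta`, `b : ℕ → ℝ`): `ConstRemainder`, `ScaleAnchor`, `.mono`, `.nonneg`, `constRemainder_of_boxRemainder'`, `scaleAnchor_of_boxRemainder`, `ScaleAnchor.eq`,
`ScaleAnchor.eq_of_smul`, `band_of_drift`, `betaUpperH_of_drift_constRemainder`, `betaLowerH_of_drift_constRemainder`, ★ `endpointExistence_of_drift_constRemainder_cont` (END from drift +
constant remainder + cap + (C) ONLY — an4's END with its ceiling DERIVED).  §2 the letter `RemAt`, `remAt_iff_hPFree`, `beta0OfJs_eq_of_remAt` (+ `_adm`), ★ `endpointExistence_of_remAt_drift`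
(END at one record from the letter at scale `c` and the BARE drift), `remAt_rescale` (covariance under `β ↦ λβ`, `c ↦ λc`).  §3 (stub texts inline) ★★ `EndpointGivenBR13SepCoPH_of_shadowingJets`
(THE CRUX DECL BY NAME), `d1AtShadowingJets_of_drift_of_anchor`, `constAnchorPackage_of_remAt_drift` (the K1 reader's ceiling + (A-ps)).  §4 lattice: `remAt_of_remAtN` (CRIT-1's repaired
linear letter ⟹ ed.3 at `θ.cβ`), `remAt_one_of_v3Package` ∕ `remAt_one_of_constAnchorPackage` (the un-normalised editions are the instances `c = 1`; P3's core likewise).  §5 (R-a) at a pin: `EndpointGivenBR13SepCoPH_of_namedJets`, `remAtSomeJets_of_remAtNamedJets`.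

HONEST FRAMING.  Definitions + elementary bookkeeping; NOTHING of Bałaban's analysis is asserted: every remainder ∕ anchor ∕ drift is a HYPOTHESIS SHAPE inhabited at no θ here
(instance 0∕1); (P6) — the VALUE of κ — and the convention constant `c⋆` are NOT decided; K2⁷ ∕ its stubs ∕ N25 ∕ N26 NOT proved; counts unmoved; [Balaban1987RG1] Thm 2 + (0.31) p. 259
(NODE O) is UNPROVED IN PRINT; route R4 closes the conditional finite-𝕋⁴ rung only — NOT the continuum limit, NOT ℝ⁴, NOT OS, NOT a mass gap, NOT Clay.  No `instance`, no `notation`,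
no `axiom`.  Sources (context only; nothing printed is used as a hypothesis): [I] = [Balaban1987RG1] CMP **109** (1987): Thm 2 p. 259 (first sentence), (1.3) p. 260, (1.20)–(1.22)
p. 264, (2.12)–(2.14) p. 268, (5.10) p. 293; [II] = [Balaban1988RG2Cluster] CMP **116** (1988): Lemma 3 (2.38) p. 20, (2.41) p. 21.
-/

noncomputable section

open scoped Matrix.Norms.L2Operator

namespace Summit.QuantumFields.YangMills.Theorems.BalabanUVNodesK2NamedJetsRemAt

open Finset
open scoped BigOperators
open Literature.MathematicalPhysics.QuantumFieldTheory.Balaban1983to89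
open Literature.MathematicalPhysics.QuantumFieldTheory.Balaban1983to89.FlowStep
open Literature.MathematicalPhysics.QuantumFieldTheory.Balaban1983to89.FlowStepRuns (BetaPartialSumsLowerH histBox_of_mem_box)
open Literature.MathematicalPhysics.QuantumFieldTheory.Balaban1983to89.DagBinding (EndpointExistence ForwardGenerated)
open Literature.MathematicalPhysics.QuantumFieldTheory.Balaban1983to89.T4Continuum (T4Family)
open Literature.MathematicalPhysics.QuantumFieldTheory.Balaban1983to89.B12Beta (HistBox)
open Literature.MathematicalPhysics.QuantumFieldTheory.Balaban1983to89.Beta.Drift (OneLoopDrift)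
open Literature.MathematicalPhysics.QuantumFieldTheory.Balaban1983to89.Beta.DriftRemainder (abs_beta0_sub_le_of_drift)
open Summit.QuantumFields.YangMills.Theorems.BalabanUVNodesK2JsOfRecord (StepColourData JsOfRecord beta0OfJs BoxRemainder)
open Summit.QuantumFields.YangMills.Theorems.BalabanUVNodesK2Line1PrimeRemainderPrice
  (betaPartialSumsLowerH_of_drift_lowerRemainder endpointExistence_of_drift_constRemainder constRemainder_of_boxRemainder eq_of_anchors anchor_of_boxRemainder)
open Summit.QuantumFields.YangMills.Theorems.EndpointGivenBR13SepCoPH.Negative.RemNamedJets13FalseOfTwoNormalisations (oneLoopDrift_const_mul)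

/-! ## §1 Generic, split-free: the constant remainder, the per-scale anchor, the band, the ceiling, the END from (C) only -/

section Generic

variable {β : HBeta} {b b' : ℕ → ℝ}

/-- HYPOTHESIS SHAPE (never a fact): **THE CONSTANT-FORM REMAINDER of `β` relative to a reference sequence `b`** — `|β_{k+1}(p) − b_k| ≤ r` on every `]0, γ₀]`-history,
all `k` (print's grade of rows (D4) ∧ B4: [II] (2.41) → [I] (5.10) → (1.22), `r = ε₁·K_rem`; an4's inline hypothesis of `endpointExistence_of_drift_constRemainder`, P3's
`BoxRemConst`).  For `b := S.β0` of a one-loop split it is `Beta.RemainderChain.RemainderConst S γ₀ r`.  A predicate over `(β, b, r, γ₀)`, never a fact;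
print context [I] (5.10) p. 293, (2.12)–(2.14) p. 268. [folklore] -/
def ConstRemainder (β : HBeta) (b : ℕ → ℝ) (r γ₀ : ℝ) : Prop :=
  ∀ (k : ℕ) (p : Fin (k + 1) → ℝ), p ∈ HistBox γ₀ k → |β k p - b k| ≤ r

/-- HYPOTHESIS SHAPE (never a fact): **THE PER-SCALE ANCHOR of `β` at `b`** — for every scale `k` and `δ > 0` some box `]0, γ]^{k+1}` on which `|β_{k+1}(p) − b_k| ≤ δ`:
`b_k` is the limit of `β_{k+1}` at the zero history, scale by scale, constants free in `k` ([I] (2.13) p. 268 «vanishes at g_k = 0» read at fixed `k`; an4's inline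
hypothesis of `eq_of_anchors`; CRIT-1's `Anchor`; line 2's S2 `AnchorVanishing` relative to a named sequence).  A predicate over `(β, b)`, never a fact; print context
[I] (2.12)–(2.14) p. 268. [folklore] -/
def ScaleAnchor (β : HBeta) (b : ℕ → ℝ) : Prop :=
  ∀ (k : ℕ) (δ : ℝ), 0 < δ → ∃ γ : ℝ, 0 < γ ∧ ∀ p : Fin (k + 1) → ℝ, p ∈ HistBox γ k → |β k p - b k| ≤ δ

/-- A constant remainder on `]0, γ₀]` restricts to every smaller box. [folklore] -/
theorem ConstRemainder.mono {r γ₀ γ₀' : ℝ} (h : ConstRemainder β b r γ₀) (hle : γ₀' ≤ γ₀) : ConstRemainder β b r γ₀' :=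
  fun k p hp => h k p fun i => ⟨(hp i).1, (hp i).2.trans hle⟩

/-- A constant remainder on a nonempty box has `0 ≤ r` (evaluate at the constant history `γ₀`). [folklore] -/
theorem ConstRemainder.nonneg {r γ₀ : ℝ} (h : ConstRemainder β b r γ₀) (hγ₀ : 0 < γ₀) : 0 ≤ r :=
  (abs_nonneg _).trans (h 0 (fun _ => γ₀) fun _ => ⟨hγ₀, le_rfl⟩)

/-- LINEAR ⟹ CONSTANT: `BoxRemainder β b C_r γ₀` with `0 ≤ C_r` is `ConstRemainder β b (C_r γ₀) γ₀` (an4's `constRemainder_of_boxRemainder` BY NAME). [folklore] -/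
theorem constRemainder_of_boxRemainder' {Cr γ₀ : ℝ} (h : BoxRemainder β b Cr γ₀) (hCr : 0 ≤ Cr) : ConstRemainder β b (Cr * γ₀) γ₀ :=
  constRemainder_of_boxRemainder h hCr

/-- LINEAR ⟹ ANCHOR: `BoxRemainder β b C_r γ₀` with `0 ≤ C_r`, `0 < γ₀` is a `ScaleAnchor β b` (an4's `anchor_of_boxRemainder` BY NAME). [folklore] -/
theorem scaleAnchor_of_boxRemainder {Cr γ₀ : ℝ} (h : BoxRemainder β b Cr γ₀) (hCr : 0 ≤ Cr) (hγ₀ : 0 < γ₀) : ScaleAnchor β b :=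
  anchor_of_boxRemainder h hCr hγ₀

/-- **AN ANCHOR DETERMINES ITS REFERENCE SEQUENCE**: two per-scale anchors of the same `β` have the same numbers (an4's `eq_of_anchors` BY NAME). [folklore] -/
theorem ScaleAnchor.eq (h : ScaleAnchor β b) (h' : ScaleAnchor β b') : b = b' :=
  eq_of_anchors h h'

/-- … and at a non-zero SCALE `c`: anchors of `β` at `c • b` and at `c • b′` give `b = b′` — the identification in the normalisation-carrying keying. [folklore] -/
theorem ScaleAnchor.eq_of_smul {c : ℝ} (hc : c ≠ 0) (h : ScaleAnchor β (fun k => c * b k)) (h' : ScaleAnchor β (fun k => c * b' k)) : b = b' := by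
  have hfun := h.eq h'
  funext k
  exact mul_left_cancel₀ hc (congrFun hfun k)

/-- **A DRIFTING REFERENCE SEQUENCE IS A BAND**: `OneLoopDrift s A b` gives `|b_k − s| ≤ 2A` for every `k` (`Beta.DriftRemainder.abs_beta0_sub_le_of_drift` BY NAME).
[cite: Balaban1988RG2Cluster, Lemma 3 (2.38) p.20] -/
theorem band_of_drift {s A : ℝ} (h : OneLoopDrift s A b) (k : ℕ) : |b k - s| ≤ 2 * A :=
  abs_beta0_sub_le_of_drift h k

/-- **THE PRINTED-TYPE CEILING FROM DRIFT + CONSTANT REMAINDER, SPLIT-FREE**: `OneLoopDrift s A b` and `ConstRemainder β b r γ₀` give `BetaUpperH (s + 2A + r) γ₀ β` — the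
split-free twin of `Beta.DriftRemainder.betaUpperH_of_drift_remainderConst`; why the ceiling conjuncts of v3's letter are a second invoice once stub 1′ supplies the drift.
[cite: Balaban1987RG1, (1.20)–(1.22) p.264 and (2.12)–(2.14) p.268] -/
theorem betaUpperH_of_drift_constRemainder {s A r γ₀ : ℝ} (hdrift : OneLoopDrift s A b) (hrem : ConstRemainder β b r γ₀) :
    BetaUpperH (s + 2 * A + r) γ₀ β := by
  intro k v hv
  have h1 := (abs_le.mp (hrem k v (histBox_of_mem_box hv))).2
  have h0 := (abs_le.mp (band_of_drift hdrift k)).2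
  linarith

/-- … and the matching FLOOR `BetaLowerH (s − 2A − r) γ₀ β` (the other half of the 3ᴬ-box a K0-side reader wants). [cite: Balaban1987RG1, (1.20)–(1.22) p.264 and (2.12)–(2.14) p.268] -/
theorem betaLowerH_of_drift_constRemainder {s A r γ₀ : ℝ} (hdrift : OneLoopDrift s A b) (hrem : ConstRemainder β b r γ₀) :
    BetaLowerH (s - 2 * A - r) γ₀ β := by
  intro k v hv
  have h1 := (abs_le.mp (hrem k v (histBox_of_mem_box hv))).1
  have h0 := (abs_le.mp (band_of_drift hdrift k)).1
  linarith

/-- **★ ENDPOINT EXISTENCE FROM A DRIFT, A CONSTANT REMAINDER WITH THE CAP `r ≤ s`, AND (C) ONLY** (forward-generated constructions): an4's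
`endpointExistence_of_drift_constRemainder` BY NAME with its ceiling `β′ := s + 2A + r ≥ 0` DERIVED (`betaUpperH_of_drift_constRemainder`, `ConstRemainder.nonneg`).  What the
END of line 1′ reads, and nothing else (any slope `s`; its sign is forced by `0 ≤ r ≤ s`). [cite: Balaban1987RG1, Thm 2 p.259 (first sentence) and (5.10) p.293] -/
theorem endpointExistence_of_drift_constRemainder_cont {C : B12.Construction} (hgen : ForwardGenerated C β) {γ₀ s A r : ℝ} (hγ₀ : 0 < γ₀)
    (hdrift : OneLoopDrift s A b) (hrem : ConstRemainder β b r γ₀) (hr : r ≤ s) (hcont : BetaContH γ₀ β) : EndpointExistence C :=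
  have hr0 : 0 ≤ r := hrem.nonneg hγ₀
  have hA : 0 ≤ A := hdrift.nonneg
  endpointExistence_of_drift_constRemainder hgen hγ₀ hdrift hrem hr (by linarith) hcont (betaUpperH_of_drift_constRemainder hdrift hrem)

end Generic

/-! ## §2 The shared letter of record, edition 3, at NODE 00's Stage-13 record (`N = 2`), read at a scale `c` -/

section Letter

/-- **THE SHARED LETTER `RemAt F κ θ hP c` — EDITION 3** (constant remainder + per-scale anchor + (C), normalisation CARRIED; the letter of record of line 1′ by its one
declarer).  At the Stage-13 record `(θ, hP)` of the family `F`, the colour datum `κ`'s NAMED one-loop numbers READ AT SCALE `c`, `k ↦ c · beta0OfJs F κ k`, SHADOW the record's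
β: on some box `]0, γ₀] ⊆ ]0, θ.γ]` the record's `β_{k+1}(p)` is within a constant `s ≤ c · stepBal 2 F.L` (the cap: at most the scaled asymptotic-freedom slope) of
`c · beta0OfJs F κ k` for all `k` (rows (D4) ∧ B4 at print's CONSTANT grade), `β_{k+1} → c · beta0OfJs F κ k` at the zero history scale by scale (the anchor — the identification;
load-bearing, file header), and (C) `BetaContH γ₀` holds on that box.  THE STUB TEXTS PUT `c := θ.cβ` (the tuple's chart constant: the record's β is degree-1 homogeneous in it,
p592392 §1; a sub-cell convention constant `c⋆ ≠ 1` would put `θ.cβ / c⋆`).  NO linear modulus, NO ceiling conjunct (derived, §1), NO `OneLoopSplit`, NO `limUnder`, NO reference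
history.  (P6) — the VALUE of κ — is UNPINNED: κ is a letter.  `hP` enters only through `(datumOfRecord₁₃SepCoPH F 2 θ hP).βfun` (`remAt_iff_hPFree`).  A predicate over
`(F, κ, θ, hP, c)`, never a fact; print context [I] (2.12)–(2.14) p. 268, (5.10) p. 293, (1.20)–(1.22) p. 264. [folklore] -/
def RemAt (F : T4Family) (κ : StepColourData) (θ : Node00.Stage13HParams F 2) (hP : θ.Provisos₁₃SepCoPH F 2) (c : ℝ) : Prop :=
  ∃ γ₀ s : ℝ, 0 < γ₀ ∧ γ₀ ≤ θ.γ ∧ s ≤ c * B12Normalization.stepBal 2 F.L ∧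
    ConstRemainder (Node00.datumOfRecord₁₃SepCoPH F 2 θ hP).βfun (fun k => c * beta0OfJs F κ k) s γ₀ ∧
    ScaleAnchor (Node00.datumOfRecord₁₃SepCoPH F 2 θ hP).βfun (fun k => c * beta0OfJs F κ k) ∧
    BetaContH γ₀ (Node00.datumOfRecord₁₃SepCoPH F 2 θ hP).βfun

variable (F : T4Family) (κ κ' : StepColourData) (θ : Node00.Stage13HParams F 2) (hP : θ.Provisos₁₃SepCoPH F 2)

/-- **`hP` IS A PHANTOM BINDER OF THE LETTER** (P3 n°82 e3 §4 (i)): the datum's β IS `betaOfRecord₁₃ F 2 θ.toStage13Params` (`Node00.βfun_datumOfRecord₁₃SepCoPH`, `rfl`), so the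
letter's CONTENT is a statement about the bare Stage-13 parameters — `Iff.rfl`.  (The keying on the provisos lives in the STUB PREFIX, §3, not in the letter.) [folklore] -/
theorem remAt_iff_hPFree (c : ℝ) :
    RemAt F κ θ hP c ↔
      ∃ γ₀ s : ℝ, 0 < γ₀ ∧ γ₀ ≤ θ.γ ∧ s ≤ c * B12Normalization.stepBal 2 F.L ∧
        ConstRemainder (Node00.betaOfRecord₁₃ F 2 θ.toStage13Params) (fun k => c * beta0OfJs F κ k) s γ₀ ∧
        ScaleAnchor (Node00.betaOfRecord₁₃ F 2 θ.toStage13Params) (fun k => c * beta0OfJs F κ k) ∧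
        BetaContH γ₀ (Node00.betaOfRecord₁₃ F 2 θ.toStage13Params) :=
  Iff.rfl

/-- **THE IDENTIFICATION (indeed IS the anchor), AT A NON-ZERO SCALE**: two colour data whose named numbers shadow the SAME record at the same scale `c ≠ 0` have the SAME named
one-loop numbers (`ScaleAnchor.eq_of_smul`) — under the letter κ is no free knob. [folklore] -/
theorem beta0OfJs_eq_of_remAt {c : ℝ} (hc : c ≠ 0) (h : RemAt F κ θ hP c) (h' : RemAt F κ' θ hP c) : beta0OfJs F κ = beta0OfJs F κ' := by
  obtain ⟨-, -, -, -, -, -, hanch, -⟩ := h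
  obtain ⟨-, -, -, -, -, -, hanch', -⟩ := h'
  exact hanch.eq_of_smul hc hanch'

/-- … at the stub texts' scale `c := θ.cβ`, for an ADMISSIBLE tuple (`0 < θ.cβ`: Stage-9 admissibility's chart clause, `Stage9Params.Admissible.chart`). [folklore] -/
theorem beta0OfJs_eq_of_remAt_adm (hθ : θ.Admissible F 2) (h : RemAt F κ θ hP θ.cβ) (h' : RemAt F κ' θ hP θ.cβ) : beta0OfJs F κ = beta0OfJs F κ' :=
  beta0OfJs_eq_of_remAt F κ κ' θ hP (ne_of_gt hθ.toStage9.chart.1) h h'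

/-- **★ THE END AT ONE RECORD FROM THE LETTER AT SCALE `c` AND THE BARE DRIFT** of the named numbers (slope `stepBal 2 F.L`): the drift is rescaled by `c`
(`oneLoopDrift_const_mul` BY NAME, p592392) to the reference sequence `c • beta0OfJs F κ` and slope `c · stepBal 2 F.L`; then `endpointExistence_of_drift_constRemainder_cont` at the
datum's `fwd`.  NO sign of `c` is read (the cap forces `0 ≤ s ≤ c · stepBal`).  The anchor and `γ₀ ≤ θ.γ` are unread here.  CONDITIONAL; K2⁷ NOT closed.
[cite: Balaban1987RG1, Thm 2 p.259 (first sentence), (5.10) p.293 and (2.12)–(2.14) p.268] -/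
theorem endpointExistence_of_remAt_drift {c : ℝ} (h : RemAt F κ θ hP c) {A : ℝ} (hdrift : OneLoopDrift (B12Normalization.stepBal 2 F.L) A (beta0OfJs F κ)) :
    EndpointExistence (Node00.datumOfRecord₁₃SepCoPH F 2 θ hP).C.toB12 := by
  obtain ⟨γ₀, s, hγ₀, -, hcap, hrem, -, hcont⟩ := h
  exact endpointExistence_of_drift_constRemainder_cont (Node00.datumOfRecord₁₃SepCoPH F 2 θ hP).fwd hγ₀ (oneLoopDrift_const_mul hdrift c) hrem hcap hcont

/-- **THE TWO-NORMALISATION WITNESS MISSES THE REPAIRED LETTER — ONE κ SERVES A TUPLE AND ITS RESCALED TWIN**: if the β of record of `(θ′, hP′)` is `λ` times that of `(θ, hP)` on a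
box `]0, γ₁]` with `0 < λ`, and `θ.γ ≤ θ′.γ`, then the letter at scale `c` for `θ` gives the letter at scale `λc` for `θ′` (window `min γ₀ γ₁`, constant `λs`).  With `c := θ.cβ` and
`θ′.cβ = λ·θ.cβ` (a basis rescaling, p592392 §1) this is exactly the covariance the repaired stub pair needs. [folklore] -/
theorem remAt_rescale {θ' : Node00.Stage13HParams F 2} {hP' : θ'.Provisos₁₃SepCoPH F 2} {lam γ₁ c : ℝ} (hlam : 0 < lam) (hγ₁ : 0 < γ₁) (hγθ : θ.γ ≤ θ'.γ)
    (hprop : ∀ (k : ℕ) (p : Fin (k + 1) → ℝ), p ∈ HistBox γ₁ k →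
      (Node00.datumOfRecord₁₃SepCoPH F 2 θ' hP').βfun k p = lam * (Node00.datumOfRecord₁₃SepCoPH F 2 θ hP).βfun k p)
    (h : RemAt F κ θ hP c) : RemAt F κ θ' hP' (lam * c) := by
  obtain ⟨γ₀, s, hγ₀, hγθ₀, hcap, hrem, hanch, hcont⟩ := h
  have hsub : ∀ {γ : ℝ} {k : ℕ} {p : Fin (k + 1) → ℝ}, p ∈ HistBox (min γ γ₁) k → p ∈ HistBox γ k ∧ p ∈ HistBox γ₁ k :=
    fun hp => ⟨fun i => ⟨(hp i).1, (hp i).2.trans (min_le_left _ _)⟩, fun i => ⟨(hp i).1, (hp i).2.trans (min_le_right _ _)⟩⟩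
  refine ⟨min γ₀ γ₁, lam * s, lt_min hγ₀ hγ₁, (min_le_left _ _).trans (hγθ₀.trans hγθ), ?_, fun k p hp => ?_, fun k δ hδ => ?_, fun k => ?_⟩
  · have := mul_le_mul_of_nonneg_left hcap hlam.le
    linarith [this]
  · obtain ⟨hp₀, hp₁⟩ := hsub hp
    have h1 : |(Node00.datumOfRecord₁₃SepCoPH F 2 θ hP).βfun k p - c * beta0OfJs F κ k| ≤ s := hrem k p hp₀
    show |(Node00.datumOfRecord₁₃SepCoPH F 2 θ' hP').βfun k p - lam * c * beta0OfJs F κ k| ≤ lam * s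
    rw [hprop k p hp₁, show lam * c * beta0OfJs F κ k = lam * (c * beta0OfJs F κ k) by ring, ← mul_sub, abs_mul, abs_of_pos hlam]
    exact mul_le_mul_of_nonneg_left h1 hlam.le
  · obtain ⟨γ, hγ, hb⟩ := hanch k (δ / lam) (div_pos hδ hlam)
    refine ⟨min γ γ₁, lt_min hγ hγ₁, fun p hp => ?_⟩
    obtain ⟨hp₀, hp₁⟩ := hsub hp
    have h1 : |(Node00.datumOfRecord₁₃SepCoPH F 2 θ hP).βfun k p - c * beta0OfJs F κ k| ≤ δ / lam := hb p hp₀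
    show |(Node00.datumOfRecord₁₃SepCoPH F 2 θ' hP').βfun k p - lam * c * beta0OfJs F κ k| ≤ δ
    rw [hprop k p hp₁, show lam * c * beta0OfJs F κ k = lam * (c * beta0OfJs F κ k) by ring, ← mul_sub, abs_mul, abs_of_pos hlam]
    calc lam * |(Node00.datumOfRecord₁₃SepCoPH F 2 θ hP).βfun k p - c * beta0OfJs F κ k| ≤ lam * (δ / lam) :=
          mul_le_mul_of_nonneg_left h1 hlam.le
      _ = δ := by field_simp
  · -- (C) on the smaller box: `β_{θ'} = lam • β_θ` there, and `β_θ` is continuous on `Box γ₀ k ⊇ Box (min γ₀ γ₁) k`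
    have hBox : Box (min γ₀ γ₁) k ⊆ Box γ₀ k := fun v hv => mem_box.mpr fun i => ⟨(mem_box.mp hv i).1, (mem_box.mp hv i).2.trans (min_le_left _ _)⟩
    have hc0 : ContinuousOn (fun v => lam * (Node00.datumOfRecord₁₃SepCoPH F 2 θ hP).βfun k v) (Box (min γ₀ γ₁) k) :=
      continuousOn_const.mul ((hcont k).mono hBox)
    refine hc0.congr fun v hv => ?_
    have hv₁ : v ∈ HistBox γ₁ k := fun i => ⟨(mem_box.mp hv i).1, (mem_box.mp hv i).2.trans (min_le_right _ _)⟩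
    exact hprop k v hv₁

end Letter

/-! ## §3 The two stub TEXTS over the letter (registration (R-b), κ-free, κ AFTER θ, scale `θ.cβ`), the composition to K2⁷ BY NAME, the use form keyed on the anchor

* STUB 2′ `RemAtSomeJets := ∀ (F : T4Family) (θ : Node00.Stage13HParams F 2) (hP : θ.Provisos₁₃SepCoPH F 2), θ.Admissible F 2 → ∃ κ : StepColourData, RemAt F κ θ hP θ.cβ`
  «rows (D4) ∧ B4 at print's constant grade + the anchor + (C), at the tuple's scale — the XL stub CHOOSES κ, per tuple» (CRIT-1: κ after θ «costs the composition nothing and does not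
  bet on threshold-independence of the germ in ν, ε₂₉, εbg»).  Size XL (wall = NODE O).
* STUB 1′ `D1AtShadowingJets := ∀ F κ θ hP, θ.Admissible F 2 → RemAt F κ θ hP θ.cβ → ∃ A, OneLoopDrift (stepBal 2 F.L) A (beta0OfJs F κ)` «row (D1) at the record, carried by the
  named jets»: the conclusion IS `D1Drift F.L (JsOfRecord F κ) 2 0 1` (`BalabanUVNodesK2JsOfRecord.d1Drift_JsOfRecord_iff`, `Iff.rfl`; instance-free spelling; BARE slope); by the anchor
  the shadowing numbers are `θ.cβ⁻¹ •` the record's zero-history limits, the same for every shadowing κ (`beta0OfJs_eq_of_remAt_adm`) — ONE drift statement per record.  Size L (+ transfer). -/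

section Stubs

/-- **★★ LINE 1′'s COMPOSITION, EDITION 3 (kernel-checked, no sorry): stub 1′ → stub 2′ → THE CRUX DECL BY NAME** (`Summit.QuantumFields.YangMills.Theses.BalabanUVNodes.EndpointGivenBR13SepCoPH`,
route rev 25; `h₁` = the stub-1′ text, `h₂` = the stub-2′ text, VERBATIM).  Per record: κ from stub 2′, the bare drift from stub 1′, `endpointExistence_of_remAt_drift` (drift rescaled by
`θ.cβ`).  The item's unity ∕ (B) ∕ window hypotheses are unused on the β-side road (as in v3).  CONDITIONAL on the two displayed hypothesis shapes; K2⁷ NOT closed; nothing of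
Bałaban asserted. [cite: Balaban1987RG1, Thm 2 p.259 (first sentence), (5.10) p.293 and (2.12)–(2.14) p.268] -/
theorem EndpointGivenBR13SepCoPH_of_shadowingJets
    (h₁ : ∀ (F : T4Family) (κ : StepColourData) (θ : Node00.Stage13HParams F 2) (hP : θ.Provisos₁₃SepCoPH F 2), θ.Admissible F 2 →
      RemAt F κ θ hP θ.cβ → ∃ A : ℝ, OneLoopDrift (B12Normalization.stepBal 2 F.L) A (beta0OfJs F κ))
    (h₂ : ∀ (F : T4Family) (θ : Node00.Stage13HParams F 2) (hP : θ.Provisos₁₃SepCoPH F 2), θ.Admissible F 2 →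
      ∃ κ : StepColourData, RemAt F κ θ hP θ.cβ) :
    Summit.QuantumFields.YangMills.Theses.BalabanUVNodes.EndpointGivenBR13SepCoPH := by
  intro F θ hP _hU hθ _hB _hwin
  obtain ⟨κ, hRem⟩ := h₂ F θ hP hθ
  obtain ⟨A, hdrift⟩ := h₁ F κ θ hP hθ hRem
  exact endpointExistence_of_remAt_drift F κ θ hP hRem hdrift

/-- **USE FORM FOR THE ROW-(D1) OWNER, KEYED ON THE ANCHOR**: «every colour datum whose `θ.cβ`-scaled named numbers are ANCHORED at an admissible proviso'd record drifts at the
bare slope `stepBal 2 F.L`» gives the stub-1′ text (the constant remainder, the cap and (C) are then unused).  This — not «row (D1) at every colour datum», which (D1) being ONE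
quartic equation in the colour data (`Gaps.D1WardNoFreeKnob.d1Drift_iff_wardNoFreeKnob`) does not offer — is the (D1) road of line 1′.
[cite: Balaban1987RG1, (1.3) p.260 and (2.12)–(2.14) p.268] -/
theorem d1AtShadowingJets_of_drift_of_anchor
    (h : ∀ (F : T4Family) (κ : StepColourData) (θ : Node00.Stage13HParams F 2) (hP : θ.Provisos₁₃SepCoPH F 2), θ.Admissible F 2 →
      ScaleAnchor (Node00.datumOfRecord₁₃SepCoPH F 2 θ hP).βfun (fun k => θ.cβ * beta0OfJs F κ k) →
      ∃ A : ℝ, OneLoopDrift (B12Normalization.stepBal 2 F.L) A (beta0OfJs F κ)) :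
    ∀ (F : T4Family) (κ : StepColourData) (θ : Node00.Stage13HParams F 2) (hP : θ.Provisos₁₃SepCoPH F 2), θ.Admissible F 2 →
      RemAt F κ θ hP θ.cβ → ∃ A : ℝ, OneLoopDrift (B12Normalization.stepBal 2 F.L) A (beta0OfJs F κ) := fun F κ θ hP hθ hRem => by
  obtain ⟨-, -, -, -, -, -, hanch, -⟩ := hRem
  exact h F κ θ hP hθ hanch

variable (F : T4Family) (κ : StepColourData) (θ : Node00.Stage13HParams F 2) (hP : θ.Provisos₁₃SepCoPH F 2)

/-- **THE OPENED PACKAGE A K1-SIDE READER WANTS**, from the letter at scale `c` and a bare drift at one record: an4-shaped conjunction with `0 ≤ s`, the (A-ps) bound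
`BetaPartialSumsLowerH (2|c|A) γ₀` (an4's `betaPartialSumsLowerH_of_drift_lowerRemainder` BY NAME) and the CEILING `BetaUpperH (c·stepBal 2 F.L + 2|c|A + s) γ₀` — so, GIVEN stub 1′
at the chosen κ, the dropped ceiling conjuncts of v3's letter are recovered BY NAME. [cite: Balaban1987RG1, (1.20)–(1.22) p.264, (1.3) p.260 and (2.12)–(2.14) p.268] -/
theorem constAnchorPackage_of_remAt_drift {c : ℝ} (h : RemAt F κ θ hP c) {A : ℝ} (hdrift : OneLoopDrift (B12Normalization.stepBal 2 F.L) A (beta0OfJs F κ)) :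
    ∃ γ₀ s : ℝ, 0 < γ₀ ∧ γ₀ ≤ θ.γ ∧ 0 ≤ s ∧ s ≤ c * B12Normalization.stepBal 2 F.L ∧
      ConstRemainder (Node00.datumOfRecord₁₃SepCoPH F 2 θ hP).βfun (fun k => c * beta0OfJs F κ k) s γ₀ ∧
      ScaleAnchor (Node00.datumOfRecord₁₃SepCoPH F 2 θ hP).βfun (fun k => c * beta0OfJs F κ k) ∧
      BetaContH γ₀ (Node00.datumOfRecord₁₃SepCoPH F 2 θ hP).βfun ∧
      BetaPartialSumsLowerH (2 * (|c| * A)) γ₀ (Node00.datumOfRecord₁₃SepCoPH F 2 θ hP).βfun ∧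
      BetaUpperH (c * B12Normalization.stepBal 2 F.L + 2 * (|c| * A) + s) γ₀ (Node00.datumOfRecord₁₃SepCoPH F 2 θ hP).βfun := by
  obtain ⟨γ₀, s, hγ₀, hγθ, hcap, hrem, hanch, hcont⟩ := h
  have hd := oneLoopDrift_const_mul hdrift c
  refine ⟨γ₀, s, hγ₀, hγθ, hrem.nonneg hγ₀, hcap, hrem, hanch, hcont, betaPartialSumsLowerH_of_drift_lowerRemainder hd fun k p hp => ?_,
    betaUpperH_of_drift_constRemainder hd hrem⟩
  have h1 := (abs_le.mp (hrem k p hp)).1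
  linarith

end Stubs

/-! ## §4 The lattice: edition 3 against CRIT-1's repaired linear letter `RemAtN`, and the un-normalised editions as the instances `c = 1` (texts VERBATIM as hypotheses; no `def`) -/

section Lattice

variable (F : T4Family) (κ : StepColourData) (θ : Node00.Stage13HParams F 2) (hP : θ.Provisos₁₃SepCoPH F 2)

/-- **CRIT-1 g2's REPAIRED LINEAR LETTER `RemAtN F κ θ hP`** (`Cruxes/…/NamedJetsNormalisation.lean` :263, P3 n°83 :508; text VERBATIM) **⟹ `RemAt F κ θ hP θ.cβ`** (`s := C_r·γ₀`; linear ⟹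
constant ∧ anchor at the scaled reference; the ceiling is discarded) — edition 3's stub 2′ is WEAKER than CRIT-1's repaired 2′ᴺ. [folklore] -/
theorem remAt_of_remAtN
    (h : ∃ γ₀ Cr β' : ℝ, 0 < γ₀ ∧ γ₀ ≤ θ.γ ∧ 0 ≤ Cr ∧ 0 ≤ β' ∧
      BoxRemainder (Node00.datumOfRecord₁₃SepCoPH F 2 θ hP).βfun (fun k => θ.cβ * beta0OfJs F κ k) Cr γ₀ ∧
      Cr * γ₀ ≤ θ.cβ * B12Normalization.stepBal 2 F.L ∧
      BetaContH γ₀ (Node00.datumOfRecord₁₃SepCoPH F 2 θ hP).βfun ∧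
      BetaUpperH β' γ₀ (Node00.datumOfRecord₁₃SepCoPH F 2 θ hP).βfun) :
    RemAt F κ θ hP θ.cβ := by
  obtain ⟨γ₀, Cr, β', hγ₀, hγθ, hCr, -, hrem, hseam, hcont, -⟩ := h
  exact ⟨γ₀, Cr * γ₀, hγ₀, hγθ, hseam, constRemainder_of_boxRemainder' hrem hCr, scaleAnchor_of_boxRemainder hrem hCr hγ₀, hcont⟩

/-- **v3's LETTER (plan g80 `K2Skeleton13SepCoPHv3.lean` :172–:177, VERBATIM) IS AN INSTANCE OF SCALE `c = 1`**: it gives `RemAt F κ θ hP 1` (`s := C_r·γ₀`).  (With its `∃ κ ∀ θ` prefix and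
the missing scale it is the edition killed modulo `TwoNormalisations`, p592392.) [folklore] -/
theorem remAt_one_of_v3Package
    (h : ∃ γ₀ Cr β' : ℝ, 0 < γ₀ ∧ γ₀ ≤ θ.γ ∧ 0 ≤ Cr ∧ 0 ≤ β' ∧
      BoxRemainder (Node00.datumOfRecord₁₃SepCoPH F 2 θ hP).βfun (beta0OfJs F κ) Cr γ₀ ∧
      Cr * γ₀ ≤ B12Normalization.stepBal 2 F.L ∧
      BetaContH γ₀ (Node00.datumOfRecord₁₃SepCoPH F 2 θ hP).βfun ∧
      BetaUpperH β' γ₀ (Node00.datumOfRecord₁₃SepCoPH F 2 θ hP).βfun) :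
    RemAt F κ θ hP 1 := by
  obtain ⟨γ₀, Cr, β', hγ₀, hγθ, hCr, -, hrem, hseam, hcont, -⟩ := h
  have e : (fun k => (1 : ℝ) * beta0OfJs F κ k) = beta0OfJs F κ := funext fun k => one_mul _
  refine ⟨γ₀, Cr * γ₀, hγ₀, hγθ, by simpa only [one_mul] using hseam, ?_, ?_, hcont⟩
  · rw [e]; exact constRemainder_of_boxRemainder' hrem hCr
  · rw [e]; exact scaleAnchor_of_boxRemainder hrem hCr hγ₀

/-- **an4's CONSTANT + ANCHOR PACKAGE 2″** (`Thm/BalabanUVNodesK2Line1PrimeRemainderPrice` §3, inline text VERBATIM) **IS AN INSTANCE OF SCALE `c = 1`**. [folklore] -/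
theorem remAt_one_of_constAnchorPackage
    (h : ∃ γ₀ s β' : ℝ, 0 < γ₀ ∧ γ₀ ≤ θ.γ ∧ 0 ≤ s ∧ s ≤ B12Normalization.stepBal 2 F.L ∧ 0 ≤ β' ∧
      (∀ (k : ℕ) (p : Fin (k + 1) → ℝ), p ∈ HistBox γ₀ k → |(Node00.datumOfRecord₁₃SepCoPH F 2 θ hP).βfun k p - beta0OfJs F κ k| ≤ s) ∧
      (∀ (k : ℕ) (δ : ℝ), 0 < δ → ∃ γ : ℝ, 0 < γ ∧ ∀ p : Fin (k + 1) → ℝ, p ∈ HistBox γ k →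
        |(Node00.datumOfRecord₁₃SepCoPH F 2 θ hP).βfun k p - beta0OfJs F κ k| ≤ δ) ∧
      BetaContH γ₀ (Node00.datumOfRecord₁₃SepCoPH F 2 θ hP).βfun ∧
      BetaUpperH β' γ₀ (Node00.datumOfRecord₁₃SepCoPH F 2 θ hP).βfun) :
    RemAt F κ θ hP 1 := by
  obtain ⟨γ₀, s, β', hγ₀, hγθ, -, hcap, -, hrem, hanch, hcont, -⟩ := h
  refine ⟨γ₀, s, hγ₀, hγθ, by simpa only [one_mul] using hcap, fun k p hp => ?_, fun k δ hδ => ?_, hcont⟩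
  · simpa only [one_mul] using hrem k p hp
  · simpa only [one_mul] using hanch k δ hδ

end Lattice

/-! ## §5 Registration (R-a) at a PINNED colour map `κ : ℕ → StepColourData` (the (P6) pin — UNPINNED in the tree today; parametric here)

Stub texts at a pin, one-liners over the letter, spelled INLINE: 2′(R-a) `∀ F θ hP, θ.Admissible F 2 → RemAt F (κ F.L) θ hP θ.cβ`; 1′(R-a) «row (D1) over the named jets VERBATIM»
`∀ F, ∃ A, OneLoopDrift (stepBal 2 F.L) A (beta0OfJs F (κ F.L))` (= `∀ F, D1Drift F.L (JsOfRecord F (κ F.L)) 2 0 1`, instance-free). -/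

section Pinned

/-- THE COMPOSITION (R-a), edition 3, kernel-checked: the crux decl BY NAME from the two stub texts at a pin `κ`. [cite: Balaban1987RG1, Thm 2 p.259 (first sentence) and (5.10) p.293] -/
theorem EndpointGivenBR13SepCoPH_of_namedJets (κ : ℕ → StepColourData)
    (h₁ : ∀ F : T4Family, ∃ A : ℝ, OneLoopDrift (B12Normalization.stepBal 2 F.L) A (beta0OfJs F (κ F.L)))
    (h₂ : ∀ (F : T4Family) (θ : Node00.Stage13HParams F 2) (hP : θ.Provisos₁₃SepCoPH F 2), θ.Admissible F 2 → RemAt F (κ F.L) θ hP θ.cβ) :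
    Summit.QuantumFields.YangMills.Theses.BalabanUVNodes.EndpointGivenBR13SepCoPH := by
  intro F θ hP _hU hθ _hB _hwin
  obtain ⟨A, hdrift⟩ := h₁ F
  exact endpointExistence_of_remAt_drift F (κ F.L) θ hP (h₂ F θ hP hθ) hdrift

/-- (R-a)'s remainder stub text at ANY pin gives (R-b)'s stub-2′ text (take `κ := κ F.L` at every tuple). [folklore] -/
theorem remAtSomeJets_of_remAtNamedJets (κ : ℕ → StepColourData)
    (h : ∀ (F : T4Family) (θ : Node00.Stage13HParams F 2) (hP : θ.Provisos₁₃SepCoPH F 2), θ.Admissible F 2 → RemAt F (κ F.L) θ hP θ.cβ) :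
    ∀ (F : T4Family) (θ : Node00.Stage13HParams F 2) (hP : θ.Provisos₁₃SepCoPH F 2), θ.Admissible F 2 → ∃ κ : StepColourData, RemAt F κ θ hP θ.cβ :=
  fun F θ hP hθ => ⟨κ F.L, h F θ hP hθ⟩

end Pinned

end Summit.QuantumFields.YangMills.Theorems.BalabanUVNodesK2NamedJetsRemAt

end
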